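import Summits.ABC.ABC.Theses.CubicResolventAllowance
import Literature.NumberTheory.CubicFields.MaximalCubicRings
import Literature.NumberTheory.Sieve.PowerfulPartDecomposition
import Literature.NumberTheory.Sieve.DivisorBound
import HarnessLib

/-!
# Stub-ideation k=2 (RESHAPE), GEN 4 — `stub_realCubic` of crux `IndexSzpiro` (stmt-ABC-22740)

Companion of `STUB-IDEAS-stub_realCubic-2.md` (gen 4).  Gen 2/3 (`StubIdeas2Sketch.lean`,
`StubIdeas2RealG3Sketch.lean`, this directory) reduced the stub to the FIXED-FORM KERNEL
`|F(u,v)| ≤ C · rad(F(u,v))^{3+ε}` on primitive points of the index form `F` of the class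
(CORE A `IndexFormSzpiroReal`, frame normalisation, closed local type table).  Gen 4 adds two moves
on that kernel, both stated over `BinaryCubic ℤ` and primitive points `P = (u,v)`:

* §A/§B/§C  **T1 — EXCEPTIONAL-SET RUNG (provable now).**  For ANY binary cubic form with
  `a ≠ 0`, `Disc ≠ 0`: `#{P primitive, |P| ≤ X : C·rad(F(P))^{3+ε} < |F(P)|} ≪ X^{2−η/3}` for every
  `η < ε/(2+ε)`.  Thin regime (§A: `|F(P)| ≤ X^{3−η}` is a sublevel set of size `≪ X^{2−η/3}`, roots
  over `ℂ`); fat regime (§B: a bad fat value has squarefull part `b > 2X²`; two primitive points of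
  the box congruent in `P¹(ℤ/b)` are COLLINEAR (`b ∣ det`, `|det| ≤ 2X² < b`), hence `= ±` each
  other; classes are counted by roots of `F mod b`, `≤ 3` per good prime power (Hensel) and
  `≤ 3·p^{v_p(Disc)}` per bad one (Stewart 1991 Thm 2); squarefull `b ≤ cX³` are `≪ X^{3/2+o(1)}`).
* §K  **T2 — NORMAL FORM of the kernel ("uniform Ridout").**  `MUR(ε/(3+ε)) ⇒ Kernel(ε) ⇒
  SUR(ε/(3+ε)) ⇒ UR₁`: the stub on the class sits between abc for the syzygy triples (MUR) and the
  purely non-archimedean "no prime power beyond the covolume" statement UR₁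
  (`p^{v_p(F(P))−1} ≤ C·|P|^{2+ε'}`), which is what the tower engine (kit job j344673) measures.

`sorry` marks PROPOSED helper lemmas (sizes in the docstrings); §B1–B2 and §K4 are proved.
-/

noncomputable section

open scoped Classical
open Polynomial NumberField WeierstrassCurve Finset
open Literature.NumberTheory.CubicFields Literature.NumberTheory.CubicFields.BinaryCubic
open Literature.NumberTheory.Sieve

namespace Summit.ABC.ABC.Cruxes.IndexSzpiro.StubIdeas2RealG4

/-! ## §0 The stub (verbatim) and basic bookkeeping -/

/-- The stub, verbatim (registered skeleton, `stub_realCubic`). -/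
def StubRealCubic : Prop :=
  ∀ ε : ℝ, 0 < ε → ∃ C : ℝ, ∀ (W : WeierstrassCurve ℚ) [W.IsElliptic] (K : Type) [Field K] [NumberField K],
    Irreducible W.twoTorsionPolynomial.toPoly → Module.finrank ℚ K = 3 →
    (∃ θ : K, aeval θ W.twoTorsionPolynomial.toPoly = 0) → 0 < NumberField.discr K →
    (W.minimalDiscriminantNorm ℤ : ℝ) ≤ C * |(NumberField.discr K : ℝ)| * (W.conductorNorm ℤ : ℝ) ^ (6 + ε)

/-- Radical of a natural number (`rad 0 = 1` by convention of `primeFactors`). -/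
def rad (n : ℕ) : ℕ := n.primeFactors.prod id

/-- `|F(P)|` — for the index form of the class and `P = (u,v)` primitive this is the INDEX
`[𝓞_K : ℤ[θ_P]]`, and `Δ_min(E_{F,P}) = 2^a 3^b · Disc F · F(P)²` (gen 2, N1★). -/
def absVal (F : BinaryCubic ℤ) (P : ℤ × ℤ) : ℕ := (F.eval P.1 P.2).natAbs

/-- Sup norm of a lattice point. -/
def supNorm (P : ℤ × ℤ) : ℤ := max |P.1| |P.2|

/-- Naive height of the form (`|F(P)| ≤ formHeight F · |P|³`). -/
def formHeight (F : BinaryCubic ℤ) : ℤ := |F.a| + |F.b| + |F.c| + |F.d|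

/-- The box of primitive points of sup norm `≤ X`. -/
def primBox (X : ℕ) : Finset (ℤ × ℤ) :=
  ((Icc (-(X : ℤ)) X) ×ˢ (Icc (-(X : ℤ)) X)).filter (fun P => Int.gcd P.1 P.2 = 1)

/-- (S) the trivial archimedean bound. -/
theorem absVal_le (F : BinaryCubic ℤ) (P : ℤ × ℤ) :
    ((absVal F P : ℕ) : ℤ) ≤ formHeight F * supNorm P ^ 3 := by
  sorry

variable (F : BinaryCubic ℤ)

/-! ## §K  T2 — the kernel and its normal forms -/

/-- The fixed-form KERNEL at exponent `3+ε` with constant `C` (= CORE A for one `F`; the stub on the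
class `K` is `∀ ε>0 ∃ C ∀ F ∈ class(K)`-uniformly, gen 2 `assemblyT`/`polySzpiro_of_stub`). -/
def Kernel (C ε : ℝ) : Prop :=
  ∀ P : ℤ × ℤ, IsCoprime P.1 P.2 → (absVal F P : ℝ) ≤ C * (rad (absVal F P) : ℝ) ^ (3 + ε)

/-- SUR — "Szpiro = uniform Ridout": the non-squarefree excess of `F(P)` is at most `|P|^{2+ε'}`,
i.e. at most (covolume of the root lattice)^{1+ε'/2}. -/
def SUR (C ε' : ℝ) : Prop :=
  ∀ P : ℤ × ℤ, IsCoprime P.1 P.2 → F.eval P.1 P.2 ≠ 0 →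
    (absVal F P : ℝ) ≤ C * (rad (absVal F P) : ℝ) * (supNorm P : ℝ) ^ (2 + ε')

/-- UR₁ — one prime at a time: no tower `p^k ∥ F(P)` much deeper than the covolume `|P|²`
(`(k−1)·log p ≤ (2+ε')·log|P| + log C`).  This is the quantity `ug` of kit job j344673. -/
def UR1 (C ε' : ℝ) : Prop :=
  ∀ P : ℤ × ℤ, IsCoprime P.1 P.2 → F.eval P.1 P.2 ≠ 0 → ∀ p : ℕ, p.Prime →
    ((p : ℝ) ^ ((absVal F P).factorization p - 1) ≤ C * (supNorm P : ℝ) ^ (2 + ε'))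

/-- MUR — abc for the syzygy triples `4H³ = G² + 27·Disc·F²` in height form
(`|P|^{1−ε'} ≤ C·rad F(P)`); the CEILING of the line (Frey–Szpiro height conjecture on the class). -/
def MUR (C ε' : ℝ) : Prop :=
  ∀ P : ℤ × ℤ, IsCoprime P.1 P.2 → F.eval P.1 P.2 ≠ 0 →
    (supNorm P : ℝ) ^ (1 - ε') ≤ C * (rad (absVal F P) : ℝ)

/-- (S, K1) `MUR(ε/(3+ε)) ⇒ Kernel(ε)` in ALL regimes: `X³ ≤ (C·rad)^{3/(1−ε')} = (C·rad)^{3+ε}` and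
`|F(P)| ≤ c_F X³`. -/
theorem kernel_of_mur {ε C : ℝ} (hε : 0 < ε) (hC : 1 ≤ C) (h : MUR F C (ε / (3 + ε))) :
    Kernel F ((formHeight F : ℝ) * C ^ (3 + ε)) ε := by
  sorry

/-- (S, K2) `Kernel(ε) ⇒ SUR(ε/(3+ε))`: `m/rad m ≤ C^{1/(3+ε)} m^{(2+ε)/(3+ε)}` and
`m ≤ c_F X³`, `3(2+ε)/(3+ε) = 2 + ε/(3+ε)`. -/
theorem sur_of_kernel {ε C : ℝ} (hε : 0 < ε) (hC : 1 ≤ C) (h : Kernel F C ε) :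
    SUR F (C * ((formHeight F : ℝ)) ^ ((2 + ε) / (3 + ε))) (ε / (3 + ε)) := by
  sorry

/-- (S, K3) `SUR ⇒ UR₁` (`p^{v_p(m)−1} ∣ m / rad m`). -/
theorem ur1_of_sur {ε' C : ℝ} (h : SUR F C ε') : UR1 F C ε' := by
  sorry

/-- (S, K4 — proved) the converse `SUR ⇒ Kernel` holds on the FAT regime `|F(P)| ≥ X^{3−η}` with
the exponent bookkeeping `(3−η)… `; stated pointwise: if `m ≤ C·r·X^{2+ε'}` and `X^{3−η} ≤ m`
then `m^{1 − (2+ε')/(3−η)} ≤ C·r`, i.e. the kernel inequality with exponent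
`(3−η)/(1−η−ε')`.  (The THIN regime is where SUR says nothing: archimedean proximity to a real
root line; there only MUR/Roth-type input bites — see the md.) -/
theorem kernel_pointwise_of_sur_fat {m r X C ε' η : ℝ} (hm : 0 < m) (hr : 0 < r) (hX : 1 < X)
    (hC : 0 < C) (hfat : X ^ (3 - η) ≤ m) (hsur : m ≤ C * r * X ^ (2 + ε'))
    (hη : 0 < 3 - η) (hpos : 0 < 2 + ε') :
    m ≤ C * r * m ^ ((2 + ε') / (3 - η)) := by
  have hXm : X ≤ m ^ (1 / (3 - η)) := by
    have h1 : (X ^ (3 - η)) ^ (1 / (3 - η)) ≤ m ^ (1 / (3 - η)) :=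
      Real.rpow_le_rpow (by positivity) hfat (by positivity)
    rwa [← Real.rpow_mul (le_of_lt (lt_trans zero_lt_one hX)), mul_one_div_cancel (ne_of_gt hη),
      Real.rpow_one] at h1
  calc m ≤ C * r * X ^ (2 + ε') := hsur
    _ ≤ C * r * (m ^ (1 / (3 - η))) ^ (2 + ε') := by
        gcongr
    _ = C * r * m ^ ((2 + ε') / (3 - η)) := by
        rw [← Real.rpow_mul (le_of_lt hm)]; ring_nf

/-! ## §A  T1, thin regime: the sublevel set `|F| ≤ Z` in the box is small -/

/-- (S, A1) integers in a real interval of radius `T`: `#{u ∈ [−X,X] : |u − c| ≤ T} ≤ 2T+1`. -/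
theorem card_near_le (X T : ℕ) (c : ℝ) :
    ((Icc (-(X : ℤ)) X).filter (fun u : ℤ => |(u : ℝ) - c| ≤ T)).card ≤ 2 * T + 1 := by
  sorry

/-- (M, A2) SUBLEVEL COUNT.  `F(u,v) = a·∏ᵢ(u − αᵢ v)` over `ℂ` (`Cubic.eq_prod_three_roots`, `a ≠ 0`);
`|F(u,v)| ≤ Z ≤ |a|T³` forces `minᵢ |u − Re(αᵢ v)| ≤ minᵢ |u − αᵢ v| ≤ T`; sum A1 over `v` and `i`. -/
theorem card_sublevel_le (ha : F.a ≠ 0) (X T : ℕ) (Z : ℝ) (hZ : Z ≤ |(F.a : ℝ)| * (T : ℝ) ^ 3) :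
    (((Icc (-(X : ℤ)) X) ×ˢ (Icc (-(X : ℤ)) X)).filter
        (fun P : ℤ × ℤ => |((F.eval P.1 P.2 : ℤ) : ℝ)| ≤ Z)).card ≤ 3 * (2 * X + 1) * (2 * T + 1) := by
  sorry

/-! ## §B  T1, fat regime: root classes, collinearity, root counts -/

/-- (S, B1 — proved) CLASS ⇒ DETERMINANT: two points congruent to the same primitive direction
`(α : β)` modulo `b` have `b ∣ det`.  (With `(α,β) := Q` itself: "same class in `P¹(ℤ/b)`" for
primitive `P, Q` is exactly `b ∣ u₁v₂ − v₁u₂` — Bombieri–Schmidt / Stewart congruence-class splitting.) -/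
theorem det_dvd_of_sameClass {b α β u₁ v₁ u₂ v₂ : ℤ} (hαβ : IsCoprime α β)
    (h₁ : b ∣ u₁ * β - v₁ * α) (h₂ : b ∣ u₂ * β - v₂ * α) : b ∣ u₁ * v₂ - v₁ * u₂ := by
  obtain ⟨x, y, hxy⟩ := hαβ
  have key : u₁ * v₂ - v₁ * u₂ =
      (x * u₂ + y * v₂) * (u₁ * β - v₁ * α) - (x * u₁ + y * v₁) * (u₂ * β - v₂ * α) := by
    linear_combination (-(u₁ * v₂ - v₁ * u₂)) * hxy
  rw [key]
  exact dvd_sub (dvd_mul_of_dvd_right h₁ _) (dvd_mul_of_dvd_right h₂ _)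

/-- (S, B2 — proved) COLLINEARITY: in the box of sup norm `X`, `|det| ≤ 2X² < b` and `b ∣ det`
force `det = 0`. -/
theorem det_eq_zero_of_lt {b X u₁ v₁ u₂ v₂ : ℤ} (hu₁ : |u₁| ≤ X) (hv₁ : |v₁| ≤ X) (hu₂ : |u₂| ≤ X)
    (hv₂ : |v₂| ≤ X) (hb : 2 * X ^ 2 < b) (hd : b ∣ u₁ * v₂ - v₁ * u₂) : u₁ * v₂ - v₁ * u₂ = 0 := by
  have hX : 0 ≤ X := le_trans (abs_nonneg _) hu₁
  have habs : |u₁ * v₂ - v₁ * u₂| < b := by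
    calc |u₁ * v₂ - v₁ * u₂| ≤ |u₁ * v₂| + |v₁ * u₂| := abs_sub _ _
      _ = |u₁| * |v₂| + |v₁| * |u₂| := by rw [abs_mul, abs_mul]
      _ ≤ X * X + X * X := by gcongr
      _ = 2 * X ^ 2 := by ring
      _ < b := hb
  exact Int.eq_zero_of_abs_lt_dvd hd habs

/-- (S, B3) two PRIMITIVE collinear points are equal up to sign. -/
theorem eq_or_eq_neg_of_det_eq_zero {u₁ v₁ u₂ v₂ : ℤ} (h₁ : IsCoprime u₁ v₁) (h₂ : IsCoprime u₂ v₂)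
    (hd : u₁ * v₂ - v₁ * u₂ = 0) : (u₂ = u₁ ∧ v₂ = v₁) ∨ (u₂ = -u₁ ∧ v₂ = -v₁) := by
  sorry

/-- (M−, B4) hence for `b > 2X²` each root class meets the primitive box in at most TWO points. -/
theorem card_class_le_two {b α β : ℤ} (hαβ : IsCoprime α β) (X : ℕ) (hb : 2 * (X : ℤ) ^ 2 < b) :
    ((primBox X).filter (fun P : ℤ × ℤ => b ∣ P.1 * β - P.2 * α)).card ≤ 2 := by
  sorry

/-- Affine root count of `F(t,1) ≡ 0 (mod n)`. -/
def rootCount (n : ℕ) : ℕ := ((range n).filter (fun t : ℕ => (n : ℤ) ∣ F.eval t 1)).card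

/-- (S, B5) CHART: if `P` is primitive, `n ∣ F(P)` and `gcd(n, a) = 1` then `gcd(v, n) = 1`, so the
class of `P` is the affine root `t ≡ u·v⁻¹`; two such points are in the same class iff `n ∣ det`. -/
theorem isCoprime_snd_of_dvd {n : ℤ} {P : ℤ × ℤ} (hP : IsCoprime P.1 P.2) (hn : n ∣ F.eval P.1 P.2)
    (ha : IsCoprime n F.a) : IsCoprime n P.2 := by
  sorry

/-- (M, B6) PACKING: a set of primitive points with `n ∣ F(P)`, pairwise in different classes
(`n ∤ det`), has at most `rootCount F n` elements when `gcd(n, a) = 1` (inject `P ↦ u·v⁻¹ mod n`). -/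
theorem card_le_rootCount {n : ℕ} (hn : 0 < n) (ha : IsCoprime (n : ℤ) F.a) (S : Finset (ℤ × ℤ))
    (hS : ∀ P ∈ S, IsCoprime P.1 P.2 ∧ (n : ℤ) ∣ F.eval P.1 P.2)
    (hsep : ∀ P ∈ S, ∀ Q ∈ S, P ≠ Q → ¬ (n : ℤ) ∣ P.1 * Q.2 - P.2 * Q.1) :
    S.card ≤ rootCount F n := by
  sorry

/-- (M, B7) MULTIPLICATIVITY (CRT, `ZMod.chineseRemainder`). -/
theorem rootCount_mul {m n : ℕ} (h : Nat.Coprime m n) :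
    rootCount F (m * n) = rootCount F m * rootCount F n := by
  sorry

/-- (M, B8) GOOD PRIME POWERS: `p ∤ a·Disc F` ⇒ at most `3` roots modulo `p^e` (distinct roots mod `p`
lift uniquely — Hensel; `Polynomial.card_roots'` over `ZMod p`). -/
theorem rootCount_primePow_le_three {p : ℕ} (hp : p.Prime) (hgood : ¬ (p : ℤ) ∣ F.a * F.disc)
    (e : ℕ) (he : 1 ≤ e) : rootCount F (p ^ e) ≤ 3 := by
  sorry

/-- (M, B9 — cite) BAD PRIME POWERS, uniformly in `e`: Stewart, J. AMS 4 (1991) Thm 2 (all solutions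
of `f ≡ 0 (p^k)` lie in `≤ deg f` classes modulo `p^{k−uᵢ}`, `uᵢ ≤ ord_p D(f)`); generous form. -/
theorem rootCount_primePow_le_bad {p : ℕ} (hp : p.Prime) (ha : ¬ (p : ℤ) ∣ F.a) (hD : F.disc ≠ 0)
    (e : ℕ) : rootCount F (p ^ e) ≤ 3 * p ^ (F.disc.natAbs.factorization p) := by
  sorry

/-- (S, B10) a BAD value has a large squarefull part: `C·rad(m)^{3+ε} < m` ⇒
`powerfulPart m > C^{1/(3+ε)} · m^{(2+ε)/(3+ε)}` (`m = exactPart·powerfulPart`, `exactPart ∣ rad`). -/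
theorem powerfulPart_gt_of_bad {m : ℕ} (hm : m ≠ 0) {C ε : ℝ} (hC : 0 < C) (hε : 0 < ε)
    (hbad : C * (rad m : ℝ) ^ (3 + ε) < m) :
    C ^ (1 / (3 + ε)) * (m : ℝ) ^ ((2 + ε) / (3 + ε)) < PowerfulPart.powerfulPart m := by
  sorry

/-- (M, B11) squarefull moduli up to `Y` weighted by root counts: `≪_{F,κ} Y^{1/2+κ}`
(`PowerfulPart.sum_filter_squarefull_le` + `rootCount ≤ 3^{ω} · 3^{ω_bad} |Disc|` + divisor bound
`exists_card_divisors_le_mul_rpow` + `∑_a a^{−3/2} ≤ 3`). -/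
theorem sum_squarefull_rootCount_le (ha : F.a ≠ 0) (hD : F.disc ≠ 0) {κ : ℝ} (hκ : 0 < κ) :
    ∃ C₁ : ℝ, ∀ Y : ℕ,
      (∑ b ∈ (Icc 1 Y).filter (fun b : ℕ => ∀ p ∈ b.primeFactors, p ^ 2 ∣ b),
        (rootCount F b : ℝ)) ≤ C₁ * (Y : ℝ) ^ (1 / 2 + κ) := by
  sorry

/-! ## §C  T1 — the rung: the exceptional set of the kernel has power-saving size -/

/-- The exceptional ("bad") set of the kernel at level `X`. -/
def badSet (C ε : ℝ) (X : ℕ) : Finset (ℤ × ℤ) :=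
  (primBox X).filter (fun P => C * (rad (absVal F P) : ℝ) ^ (3 + ε) < (absVal F P : ℝ))

/-- (L, C1 = THE RUNG) **exceptional-set index-form Szpiro**: for every binary cubic form with
`a ≠ 0`, `Disc ≠ 0` (irreducibility, maximality, sign NOT needed), every `ε > 0`, `C > 0` and
`0 < η < ε/(2+ε)`: `#badSet ≤ C' · X^{2 − η/3}`.  Assembly: thin part by A2 with `Z = X^{3−η}`,
`T = ⌈(Z/|a|)^{1/3}⌉`; fat part: B10 gives `b := powerfulPart |F(P)| > C^{1/(3+ε)} X^{2+γ} > 2X²`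
(`γ = (ε − 2η − ηε)/(3+ε) > 0`, `X ≥ X₀(C,ε,η)`), B4–B9 give `≤ 2·rootCount-type(b)` bad points per
modulus `b`, B11 sums over squarefull `b ≤ formHeight·X³`. -/
theorem card_badSet_le (ha : F.a ≠ 0) (hD : F.disc ≠ 0) {ε C η : ℝ} (hε : 0 < ε) (hC : 0 < C)
    (hη : 0 < η) (hηε : η < ε / (2 + ε)) :
    ∃ C' : ℝ, ∀ X : ℕ, ((badSet F C ε X).card : ℝ) ≤ C' * (X : ℝ) ^ (2 - η / 3) := by
  sorry

/-- (L, C2) UNIFORM version (allowance-flavoured): the constant is polynomial in the height of the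
form, hence in `|Disc| = |d_K|` for Hessian-reduced index forms — `C' = C''(ε,C,η) · formHeight^{2}`
is a safe exponent (`thin: (Z/|a|)^{1/3}`, fat: `|Disc|·formHeight^{1/2+κ}`). -/
theorem card_badSet_le_uniform {ε C η : ℝ} (hε : 0 < ε) (hC : 0 < C) (hη : 0 < η)
    (hηε : η < ε / (2 + ε)) :
    ∃ C'' : ℝ, ∀ F : BinaryCubic ℤ, F.a ≠ 0 → F.disc ≠ 0 → ∀ X : ℕ,
      ((badSet F C ε X).card : ℝ) ≤ C'' * (formHeight F : ℝ) ^ (2 : ℝ) * (X : ℝ) ^ (2 - η / 3) := by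
  sorry

/-! ## §D  Sanity: the dictionary used by the engine (kit j344673) -/

/-- (S, D1) For `m ≠ 0`: `rad m ∣ m` and `m / rad m = ∏ p^{v_p − 1}` — the "tower gap" is
`log(m / rad m)`; UR₁/SUR bound it by `(2+ε') log|P| + O(1)`. -/
theorem rad_dvd (m : ℕ) (hm : m ≠ 0) : rad m ∣ m := by
  unfold rad
  exact Nat.prod_primeFactors_dvd m

end Summit.ABC.ABC.Cruxes.IndexSzpiro.StubIdeas2RealG4
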